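import Summits.HodgeConjecture.CorCM.AndreSplitWeilTypeHyperbolic
import Summits.HodgeConjecture.CorCM.AndreSplitFormHolds
import Literature.AlgebraicGeometry.HodgeTheory.WeilClassesCMReductionHyperbolic
import HarnessLib

/-!
# COR-CM (cell `pub-hodgecm2`), André 1992 / Milne 2020 Thm. 1 with HYPERBOLIC split targets: on a complex abelian
# variety of CM type every Hodge class is a sum of pull-backs of Weil classes from abelian varieties OF CM TYPE whose
# Weil structure relative to one Galois CM field «admits a totally isotropic subspace of dimension `d/2`»

Literature seat `lit-milne` (gen 57), count-neutral for the binder table; THEOREMS ONLY (no definition, no named fact,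
D-0026). Sequel of `AndreSplitFormHolds` (gen 56: the targets of SPLIT Weil type in the sense `disc = (-1)^p`, Deligne
Cor. 4.2 (a), `IsSplitWeilTypeCM`); here the targets carry, for ONE polarization class, Deligne's (a) AND (b) — the
Literature predicate `HodgeTheory.IsHyperbolicWeilTypeCM` (`WeilClassesCMReductionHyperbolic`), whose (b)-half is the
tree's carrier `Motives.IsHyperbolicWeilType B η (p·e₀) h` of ring 2's Weil-type ladder. HONEST FRAMING: André's theorem
is a structure statement about the Hodge ring of a CM abelian variety; NO case of the Hodge conjecture is proved here —
`HC_CM` appears only in `hc_cm_of_hyperbolicWeilClassesCM`, under the displayed binder `hW` (algebraicity of the Weil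
classes at the CM points of the hyperbolic split components — open beyond the known cases).

Milne, arXiv:2010.08857, §3 proof of Thm. 1: «Let `F` be a CM subfield of `ℂ`, Galois over `ℚ`, splitting the centre
of `End⁰(A)`. […] We shall show that Theorem 1 holds with each `A_Δ` of split Weil type relative to `F`. […] the
abelian variety `A_Δ := ∏_{s∈Δ} A_s` equipped with the diagonal action of `F` is of split Weil type. […] `A_Δ` has
complex multiplication by `F^Δ`»; 2.1: «split (i.e., admits a totally isotropic subspace of dimension `d/2`)».

The assembly is that of `AndreSplitFormHolds` (domination by a biproduct of realisations of CM types of one Galois CM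
field `F ⊇ ℚ(ζ₅)`, `[F:ℚ] > 2`, via Riemann's theorem `deligneMilne1982_Thm_6_20_full_holds`; André's product form; the
constant-sum slot products `A_Δ`; Deligne's presentation at a purely imaginary separating `b₀ ∈ 𝓞_F`), with the targets'
hyperbolicity from `AndreSplitWeilTypeHyperbolic.exists_polarizationClass_hyperbolic_of_constantSum`.

* `isHyperbolicWeilTypeCM_of_constantSum` — the constant-sum products satisfy `IsHyperbolicWeilTypeCM`;
* `andre1992_hyperbolic_of_avDominatedBy_biproduct`, `andre1992_hyperbolic_two_lt_of_riemann` — the assembly;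
* **`andre1992_hodgeClasses_cmType_mem_span_pullback_hyperbolicWeilClassesCM_holds`** — André's theorem with the
  hyperbolic split targets, hypothesis-free (the gen-56 record with Deligne's (a) only follows from it by
  `hyperbolicWeilClassPullbacksCM_subset_splitWeilClassPullbacksCM`; not restated here — it is already the tree's
  `andre1992_hodgeClasses_cmType_mem_span_pullback_splitWeilClassesCM_holds`);
* `hc_cm_of_hyperbolicWeilClassesCM (hW) : HC_CM` — André's reduction with the printed precision «split = admits a
  totally isotropic subspace of dimension `d/2`» (sharpening gen 56's `hc_cm_of_splitWeilClassesCM`);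
* `hc_cm_of_weilClassesCMField_cmType_hyperbolic (hW) : HC_CM` — the same with the binder in the shape of ring 2's
  rung R3 `WeilTypeLadder.WeilClassesCMField` restricted to CM-type, hyperbolic-split members (sharpening the cell's
  `Milne2020.hc_cm_of_weilClassesCMField`).

## References
* [Andre1992HodgeCM] Y. André, *Une remarque à propos des cycles de Hodge de type CM* (1992), Théorème, p. 2.
* [Milne2020HodgeClassesAV] J. S. Milne, arXiv:2010.08857, §2 2.1–2.2, §3 Thm. 1 and proof.
* [Deligne1982HodgeCycles] P. Deligne (notes by J. S. Milne), LNM 900 (1982), §4 Cor. 4.2; §5 (c) pp. 38–39.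
* [CharlesSchnell2014Notes] F. Charles, C. Schnell (2014), Thm. 11.5.21 / arXiv Thm. 78, Def. 76, Prop. 11.5.22.
* [DeligneMilne1982Tannakian] P. Deligne, J. S. Milne, *Tannakian categories*, LNM 900, §6 Thm. 6.20.
* [Markman2025SurveySecant] E. Markman, arXiv:2509.23403, §1.1.
* [Milne1999] J. S. Milne, *Lefschetz motives and the Tate conjecture*, Compositio Math. 117 (1999), §7 p. 72.
-/

noncomputable section

namespace Summit.HodgeConjecture.CorCM.AndreSplit

open CategoryTheory CategoryTheory.Limits Polynomial NumberField
open Literature.AlgebraicTopology.SingularHomology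
open Literature.AlgebraicGeometry Literature.AlgebraicGeometry.Motives Literature.AlgebraicGeometry.HodgeTheory
open Literature.AlgebraicGeometry.ComplexMultiplication Literature.AlgebraicGeometry.Deligne1982
open Literature.AlgebraicGeometry.Milne1999
open Summit.HodgeConjecture.CorCM.AndreProductForm Summit.HodgeConjecture.CorCM.Milne2020
open Summit.HodgeConjecture.CorCM.Domination Summit.HodgeConjecture.CorCM.AndreRiemann

/-! ## The constant-sum products are hyperbolic split Weil-type CM data -/

section Targets

variable (K : Type) [Field K] [NumberField K] [IsCMField K] [IsGalois ℚ K]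

open scoped Classical in
/-- **André's constant-sum products satisfy `IsHyperbolicWeilTypeCM`** (Weil type, and ONE polarization class with
Rosati involution complex conjugation on `E`, `disc = (-1)^p`, and an `η`-stable rational Lagrangian of dimension
`dim ⨁B`): `AndreSplitWeilTypeHyperbolic.exists_polarizationClass_hyperbolic_of_constantSum` packaged in the Literature
predicate. [cite: Milne2020HodgeClassesAV, §2 2.1–2.2 and §3 proof of Thm. 1] [cite: Deligne1982HodgeCycles, §4 Cor. 4.2, §5 (c)] -/
theorem isHyperbolicWeilTypeCM_of_constantSum (hK : 2 < Module.finrank ℚ K)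
    {d p : ℕ} (hd : d = 2 * p) (hp : 0 < p) (B : Fin d → AbelianVariety ℂ)
    (act : ∀ j, 𝓞 K →+* End (B j)) {θB : ∀ j, K →+* Module.End ℂ (complexBetti (B j).X 1)}
    {Ψ : Fin d → CMType K} (hB : ∀ j, IsCMTypeRealisation (Ψ j) (B j) (act j) (θB j))
    (hadm : ∀ s : K →+* ℂ, (Finset.univ.filter fun j : Fin d => s ∈ (Ψ j).1).card = p)
    {b₀ : 𝓞 K} (hb₀ : IsCMField.complexConj K (b₀ : K) = -(b₀ : K))
    (hsep : Function.Injective fun σ : K →+* ℂ => σ (b₀ : K))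
    {R : Polynomial ℤ} {e₀ : ℕ} (he : Module.finrank ℚ K = 2 * e₀) (hRm : R.Monic) (hRdeg : R.natDegree = e₀)
    (hR : R.comp (X ^ 2) = minpoly ℤ b₀) (hirr : Irreducible (cmPolyQ R))
    (hroots : ∀ s : ℂ, Polynomial.eval₂ (Int.castRingHom ℂ) s R = 0 → s.im = 0 ∧ s.re < 0)
    (haev : Polynomial.aeval (b₀ : K) (cmPolyQ R) = 0) (hdegQ : (cmPolyQ R).natDegree = Module.finrank ℚ K) :
    IsHyperbolicWeilTypeCM (⨁ B) (diagHom K B act b₀) R e₀ p := by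
  have hW : IsWeilTypeCM (⨁ B) (diagHom K B act b₀) R e₀ p :=
    isWeilTypeCM_diagHom K hd hp B act hB hadm b₀ hsep he hRm hRdeg hR hirr hroots
  haveI : Fact (Irreducible (realPolyQ R)) := hW.fact_irreducible_map_real
  obtain ⟨h, hpol, hros, hdisc, hhyp⟩ := exists_polarizationClass_hyperbolic_of_constantSum K hK hd hp B act hB hadm
    hb₀ hsep he hRm hRdeg hR hirr hroots haev hdegQ
  exact IsHyperbolicWeilTypeCM.intro' hW h hpol hros hdisc hhyp

end Targets

/-! ## The assembly: André's theorem with hyperbolic split targets HOLDS, and `HC_CM` from their Weil classes -/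

section Assembly

open Literature.NumberTheory.Automorphic

open scoped Classical in
/-- **André's theorem with HYPERBOLIC split targets, from a domination by a biproduct of realisations** (the assembly
of `andre1992_split_of_avDominatedBy_biproduct` with the sharper attribute of the targets). If `A` is dominated
(`s ≫ π = [N]`, `N ≠ 0`) by `⨁_j A'_j`, the `A'_j` realising CM types `Ψ_j` of a Galois CM field `F` with `[F:ℚ] > 2`, and
`b₀ ∈ 𝓞_F` is purely imaginary separating with `R(T²) = minpoly_ℤ(b₀)`, then for `p > 0` every rational `(p,p)` class
on `A` lies in the `ℂ`-span of `hyperbolicWeilClassPullbacksCM A R e₀ p`: André's product form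
(`AndreProductForm.andre1992_hodgeClasses_cmTypedProduct_mem_span_pullback_weilLines_holds`) on `π^* c`, pushed back by
`s^*`; each generator has target `A_Δ = ⨁_j A'_{i_j}` OF CM TYPE (`CMProductEnd.isOfCMType_biproduct_fin_iff`) and of
HYPERBOLIC split Weil type relative to `E = ℚ(b₀)` (`isHyperbolicWeilTypeCM_of_constantSum`), and
`t ∈ weilLineClasses ≤ weilClassesField` (`Milne2020.weilLineClasses_le_weilClassesField`).
[cite: Milne2020HodgeClassesAV, §3 Thm. 1 (proof) and §2 2.1] [cite: Andre1992HodgeCM, Théorème] [cite: Deligne1982HodgeCycles, §5 (c), §4 Cor. 4.2 (b)] -/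
theorem andre1992_hyperbolic_of_avDominatedBy_biproduct {F : Type} [Field F] [NumberField F] [IsCMField F]
    [IsGalois ℚ F] (hF2 : 2 < Module.finrank ℚ F) {n : ℕ} {A' : Fin n → AbelianVariety ℂ} {Ψ : Fin n → CMType F}
    {ι' : ∀ j, 𝓞 F →+* End (A' j)} {θ' : ∀ j, F →+* Module.End ℂ (complexBetti (A' j).X 1)}
    (hA' : ∀ j, IsCMTypeRealisation (Ψ j) (A' j) (ι' j) (θ' j)) {A : AbelianVariety ℂ}
    (hdom : AVDominatedBy A (⨁ A')) {b₀ : 𝓞 F} (hb₀ : IsCMField.complexConj F (b₀ : F) = -(b₀ : F))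
    (hsep : Function.Injective fun σ : F →+* ℂ => σ (b₀ : F))
    {R : Polynomial ℤ} {e₀ : ℕ} (he : Module.finrank ℚ F = 2 * e₀) (hRm : R.Monic) (hRdeg : R.natDegree = e₀)
    (hR : R.comp (X ^ 2) = minpoly ℤ b₀) (hirr : Irreducible (cmPolyQ R))
    (hroots : ∀ s : ℂ, Polynomial.eval₂ (Int.castRingHom ℂ) s R = 0 → s.im = 0 ∧ s.re < 0)
    (haev : Polynomial.aeval (b₀ : F) (cmPolyQ R) = 0) (hdegQ : (cmPolyQ R).natDegree = Module.finrank ℚ F)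
    {p : ℕ} (hp : 0 < p) (c : complexBetti A.X (2 * p))
    (hcQ : IsRationalClass c) (hcH : IsOfHodgeType A.dim A.X (2 * p) p p c) :
    c ∈ Submodule.span ℂ (hyperbolicWeilClassPullbacksCM A R e₀ p) := by
  obtain ⟨s, π, N, hN, hsπ⟩ := hdom
  -- André's product form on `⨁ A'` applied to `π^* c`
  have hc₁ := HodgeTheory.AbelianVariety.mapsTo_hodgeClasses π p ⟨hcQ, hcH⟩
  have handre := andre1992_hodgeClasses_cmTypedProduct_mem_span_pullback_weilLines_holds F n A' Ψ ι' θ'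
    hA' p (complexBetti.map π.hom.hom.hom (2 * p) c) hc₁.1 hc₁.2
  -- push through the domination: `s^* (π^* c) = N^{2p} • c`
  set L : complexBetti (⨁ A').X (2 * p) →ₗ[ℂ] complexBetti A.X (2 * p) :=
    (complexBetti.map s.hom.hom.hom (2 * p)).hom with hL
  have hLc : L (complexBetti.map π.hom.hom.hom (2 * p) c) = ((N : ℂ) ^ (2 * p)) • c :=
    complexBetti_map_map_of_comp_eq_nsmul_id hsπ (2 * p) c
  have hmem := Submodule.apply_mem_span_image_of_mem_span L handre
  rw [hLc] at hmem
  have hNC : ((N : ℂ) ^ (2 * p)) ≠ 0 := pow_ne_zero _ (Nat.cast_ne_zero.mpr hN)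
  rw [← inv_smul_smul₀ hNC c]
  refine Submodule.smul_mem _ _ (Submodule.span_mono ?_ hmem)
  -- the image of André's generators lies in `hyperbolicWeilClassPullbacksCM`
  rintro _ ⟨c', ⟨i, e, t, -, hcs, htQ, htH, htW, rfl⟩, rfl⟩
  let Bs : Fin (2 * p) → AbelianVariety ℂ := fun j => A' (i j)
  let act : ∀ j, 𝓞 F →+* End (Bs j) := fun j =>
    (ι' (i j)).comp (RingOfIntegers.mapRingEquiv (e j).symm).toRingHom
  have hBs : ∀ j, IsCMTypeRealisation (PicardCM.CMCode.cmTypeMap (e j) (Ψ (i j))) (Bs j) (act j)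
      ((θ' (i j)).comp (e j).symm.toRingHom) := fun j => slot_isCMTypeRealisation (hA' (i j)) (e j)
  have hnc : ∀ P : Fin (2 * p) → Prop, (Finset.univ.filter P).card = {j | P j}.ncard := by
    intro P
    rw [Set.ncard_eq_toFinset_card', Set.toFinset_setOf]
  have hadm : ∀ σ : F →+* ℂ,
      (Finset.univ.filter fun j : Fin (2 * p) => σ ∈ (PicardCM.CMCode.cmTypeMap (e j) (Ψ (i j))).1).card = p :=
    fun σ => (hnc _).trans (hcs σ)
  have hHyp := isHyperbolicWeilTypeCM_of_constantSum F hF2 rfl hp Bs act hBs hadm hb₀ hsep he hRm hRdeg hR hirr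
    hroots haev hdegQ
  have hCM : IsOfCMType (⨁ Bs) := (CMProductEnd.isOfCMType_biproduct_fin_iff Bs).2 fun j => (hBs j).isOfCMType
  refine ⟨⨁ Bs, s ≫ multiDiagonal A' i, diagHom F Bs act b₀, t, hCM, hHyp, ?_, htQ, htH, ?_⟩
  · rw [hR]
    exact weilLineClasses_le_weilClassesField F Bs act b₀ (2 * p) htW
  · rw [complexBetti_map_comp_hom]
    rfl

/-- **André's theorem with hyperbolic split targets — working form with the degree bound `[F:ℚ] = 2e₀ > 2`, modulo
Riemann's theorem.** For every complex abelian variety `A` of CM type there is ONE Galois CM field polynomial `R(T²)`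
of degree `2e₀ > 2` such that for every `p > 0` every rational `(p,p)` class on `A` is a `ℂ`-combination of pull-backs
along homomorphisms `A ⟶ B` of rational `(p,p)` Weil classes of abelian varieties `B` OF CM TYPE and of HYPERBOLIC
split Weil type relative to `ℚ[T]/(R(T²))` of `E`-rank `2p`. [cite: Milne2020HodgeClassesAV, §3 Thm. 1 and proof]
[cite: Andre1992HodgeCM, Théorème] [cite: DeligneMilne1982Tannakian, §6 Thm. 6.20 (Riemann)] -/
theorem andre1992_hyperbolic_two_lt_of_riemann (hRi : DeligneMilne1982_Thm_6_20_full) (A : AbelianVariety ℂ)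
    (hCM : IsOfCMType A) :
    ∃ (R : Polynomial ℤ) (e₀ : ℕ), IsGaloisCMFieldPoly (R.comp (X ^ 2)) (2 * e₀) ∧ 2 < 2 * e₀ ∧
      ∀ (p : ℕ), 0 < p → ∀ (c : complexBetti A.X (2 * p)), IsRationalClass c →
        IsOfHodgeType A.dim A.X (2 * p) p p c → c ∈ Submodule.span ℂ (hyperbolicWeilClassPullbacksCM A R e₀ p) := by
  obtain ⟨F, _instF, _instNF, _instCM, hGal, h2, n, B, Φ, ι, θ, hB, hdom⟩ :=
    exists_avDominatedBy_biproduct_realisations_of_riemann' hRi A hCM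
  haveI : IsGalois ℚ F := hGal
  obtain ⟨b₀, hb₀, hsep⟩ := exists_imaginary_separating F
  obtain ⟨R, e₀, he, hRm, hRdeg, hR, hirr, hroots, haev, hdegQ, hGalP⟩ := exists_sq_eq_minpoly hb₀ hsep
  exact ⟨R, e₀, hGalP, he ▸ h2, fun p hp c hcQ hcH =>
    andre1992_hyperbolic_of_avDominatedBy_biproduct h2 hB hdom hb₀ hsep he hRm hRdeg hR hirr hroots haev hdegQ hp c
      hcQ hcH⟩

/-- **André 1992 / Milne 2020 Thm. 1 with the targets of split Weil type IN THE PRINTED SENSE** («admits a totally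
isotropic subspace of dimension `d/2`», Milne 2.1; Deligne Cor. 4.2 (b); Charles–Schnell Def. 76; André 1996 `(*)`),
hypothesis-free (Riemann's theorem is the tree's `deligneMilne1982_Thm_6_20_full_holds`): on every complex abelian variety
`A` of CM type there is ONE Galois CM field `E ≅ ℚ[T]/(R(T²))` such that for every `p > 0` every rational `(p,p)` class
is a `ℂ`-combination of pull-backs `g^*(w)` along homomorphisms `g : A ⟶ B` of rational `(p,p)` Weil classes
`w ∈ W_E(B) ⊗ ℂ`, every `B` being OF CM TYPE, of Weil type relative to `E` of `E`-rank `2p`, with ONE polarization class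
whose Rosati involution is complex conjugation on `E`, of discriminant `(-1)^p` AND with an `E`-stable rational Lagrangian
of half dimension (`HodgeTheory.IsHyperbolicWeilTypeCM`). Weaker than print only where `WeilClassesCMReductionSplit`
already is (one admissible `F` asserted, product structure of `A_Δ` forgotten, `ℂ`-span, `p = 0` omitted). No case of
the Hodge conjecture is proved here. [cite: Andre1992HodgeCM, Théorème] [cite: Milne2020HodgeClassesAV, §2 2.1 and §3 Thm. 1 with proof]
[cite: Deligne1982HodgeCycles, §4 Cor. 4.2 (a)–(b), §5 (c)] [cite: CharlesSchnell2014Notes, Thm. 78 with Def. 76] -/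
theorem andre1992_hodgeClasses_cmType_mem_span_pullback_hyperbolicWeilClassesCM_holds (A : AbelianVariety ℂ)
    (hCM : IsOfCMType A) :
    ∃ (R : Polynomial ℤ) (e₀ : ℕ), IsGaloisCMFieldPoly (R.comp (X ^ 2)) (2 * e₀) ∧
      ∀ (p : ℕ), 0 < p → ∀ (c : complexBetti A.X (2 * p)), IsRationalClass c →
        IsOfHodgeType A.dim A.X (2 * p) p p c → c ∈ Submodule.span ℂ (hyperbolicWeilClassPullbacksCM A R e₀ p) :=
  let ⟨R, e₀, hP, _, h⟩ := andre1992_hyperbolic_two_lt_of_riemann deligneMilne1982_Thm_6_20_full_holds A hCM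
  ⟨R, e₀, hP, h⟩

/-- **`HC_CM` from the algebraicity of the Weil classes at the CM points of the HYPERBOLIC split `(E, 2p)`-components of
the Galois CM fields — no record.** If for every Galois CM field `E ≅ ℚ[T]/(R(T²))` the rational `(p,p)` classes of
`weilClassesField B η (R(T²)) (2p)` are algebraic on every complex abelian variety `B` OF CM TYPE with
`IsHyperbolicWeilTypeCM B η R e₀ p` (Weil type of `E`-rank `2p` and a polarization class with Rosati = complex
conjugation, `disc = (-1)^p`, and an `E`-stable rational Lagrangian of dimension `dim B`) — binder `hW`, open beyond the
known cases, taken as a hypothesis —, then the Hodge conjecture holds for all complex abelian varieties of CM type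
(`HC_CM`). This sharpens gen 56's `hc_cm_of_splitWeilClassesCM` (targets with `disc = (-1)^p` only) to the printed
«totally isotropic subspace of dimension `d/2`» (Markman: «André reduced the Hodge conjecture for abelian varieties of
CM-type to the question of algebraicity of the Weil classes on abelian varieties of split Weil type»).
[cite: Andre1992HodgeCM, p. 2 and Théorème] [cite: Milne2020HodgeClassesAV, §2 2.1, §3 Thm. 1]
[cite: Markman2025SurveySecant, §1.1 (before Thm. 1.4)] [cite: Milne1999, §7 p. 72 (hypothesis (H))] -/
theorem hc_cm_of_hyperbolicWeilClassesCM
    (hW : ∀ (R : Polynomial ℤ) (e₀ : ℕ), IsGaloisCMFieldPoly (R.comp (Polynomial.X ^ 2)) (2 * e₀) →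
      ∀ (B : AbelianVariety ℂ) (η : B ⟶ B) (p : ℕ), Milne1999.IsOfCMType B →
        IsHyperbolicWeilTypeCM B η R e₀ p →
          ∀ w ∈ weilClassesField B η (R.comp (Polynomial.X ^ 2)) (2 * p), IsRationalClass w →
            IsOfHodgeType B.dim B.X (2 * p) p p w → w ∈ algebraicClasses B.X p) :
    HC_CM :=
  hc_cm_iff_forall_cmHodgeHypothesisAt.mpr fun A =>
    cmHodgeHypothesisAt_of_span_hyperbolicWeilClassPullbacksCM
      (andre1992_hodgeClasses_cmType_mem_span_pullback_hyperbolicWeilClassesCM_holds A) hW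

/-- **Ring 2's rung R3 (`WeilTypeLadder.WeilClassesCMField`: «the Weil classes for CM fields `K` with `[K:ℚ] > 2`
are algebraic») RESTRICTED to the members that are OF CM TYPE and HYPERBOLIC split (a polarization class with Rosati =
complex conjugation on `K` and a `K`-stable rational Lagrangian of dimension `dim B`) already implies `HC_CM`** — no
record. The binder `hW` is R3's statement, symbol for symbol (`(B, ψ, P, e, m)`, `P` monic irreducible of degree
`e > 2` with no real root and a conjugation polynomial, `e · 2m = 2 dim B`), with the two extra hypotheses
`Milne1999.IsOfCMType B` and `∃ h, IsPolarizationClass ∧ Rosati-skew ∧ Motives.IsHyperbolicWeilType B ψ (m · (e/2)) h`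
inserted; the conclusion is the Hodge conjecture for all complex abelian varieties of CM type. Proof: André's theorem
with hyperbolic targets in the working form `andre1992_hyperbolic_two_lt_of_riemann` (`E = ℚ[T]/(R(T²))` Galois of
degree `2e₀ > 2`), Riemann's theorem being the tree's `deligneMilne1982_Thm_6_20_full_holds`. This sharpens the cell's
`Milne2020.hc_cm_of_weilClassesCMField (hR3) : HC_CM` (all Weil-type members). No case of the Hodge conjecture is proved
here. [cite: Andre1992HodgeCM, Théorème and p. 2] [cite: Milne2020HodgeClassesAV, §2 2.1, §3 Thm. 1]
[cite: Markman2025SurveySecant, §12 and §1.1] [cite: MoonenZarhin1998WeilClasses, §1] -/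
theorem hc_cm_of_weilClassesCMField_cmType_hyperbolic
    (hW : ∀ (B : AbelianVariety ℂ) (ψ : B ⟶ B) (P : Polynomial ℤ) (e m : ℕ),
      P.Monic → P.natDegree = e → 2 < e → Irreducible (P.map (Int.castRingHom ℚ)) →
      Polynomial.eval₂ (Int.castRingHom (CategoryTheory.End B)) (ψ : CategoryTheory.End B) P = 0 →
      e * (2 * m) = 2 * B.dim →
      (∀ ρ : ℂ, Polynomial.eval₂ (Int.castRingHom ℂ) ρ P = 0 → starRingEnd ℂ ρ ≠ ρ) →
      (∃ Q : Polynomial ℚ, ∀ ρ : ℂ, Polynomial.eval₂ (Int.castRingHom ℂ) ρ P = 0 →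
          Polynomial.eval₂ (algebraMap ℚ ℂ) ρ Q = starRingEnd ℂ ρ) →
      Milne1999.IsOfCMType B →
      (∃ h : complexBetti B.X 2, IsPolarizationClass B.dim B.X h ∧
        (∀ x y : complexBetti B.X 1,
          polarizationPairingOne B.X h (B.dim - 1) (VanGeemen1994.pullbackOne B ψ x) y =
            -polarizationPairingOne B.X h (B.dim - 1) x (VanGeemen1994.pullbackOne B ψ y)) ∧
        IsHyperbolicWeilType B ψ (m * (e / 2)) h) →
      ∀ c ∈ weilClassesField B ψ P (2 * m), IsRationalClass c →
        IsOfHodgeType B.dim B.X (2 * m) m m c → c ∈ algebraicClasses B.X m) :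
    HC_CM := by
  refine hc_cm_iff_forall_cmHodgeHypothesisAt.mpr fun A hX hCM => ⟨nonempty_hodgeModel_holds hX, fun p c hcQ hcH => ?_⟩
  rcases Nat.eq_zero_or_pos p with rfl | hp
  · rw [algebraicClasses_zero]
    exact Submodule.mem_top
  obtain ⟨R, e₀, hP, h2, hspan⟩ :=
    andre1992_hyperbolic_two_lt_of_riemann deligneMilne1982_Thm_6_20_full_holds A hCM
  refine (Submodule.span_le.mpr ?_) (hspan p hp c hcQ hcH)
  rintro _ ⟨B, g, η, w, hB, hS, hw, hwQ, hwH, rfl⟩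
  refine map_mem_algebraicClasses_of_abelianVariety (Motives.AbelianVariety.isSmoothProjective_holds (A := A)) B
    g.hom.hom.hom ?_
  obtain ⟨h, hpol, hros, hhyp⟩ := hS.exists_isHyperbolicWeilType
  have hWt := hS.isWeilTypeCM
  refine hW B η (R.comp (Polynomial.X ^ 2)) (2 * e₀) p hP.1 hP.2.1 h2 hP.2.2.2.1 hWt.eval₂_eq_zero ?_
    hP.2.2.2.2.1 hP.2.2.2.2.2.1 hB ⟨h, hpol, hros, ?_⟩ w hw hwQ hwH
  · rw [hWt.dim_eq]; ring
  · rw [Nat.mul_div_cancel_left _ two_pos]; exact hhyp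

end Assembly

end Summit.HodgeConjecture.CorCM.AndreSplit

end
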